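import Summits.ValiantsHypothesis.ValiantsHypothesis.Theorems.BarrierLeverAnchoredDoorHitsLowerPairsRouting

/-!
# Support item `AnchoredDoorHitsLowerPairs` (stmt-ValiantsHypothesis-22510), line `anchored-peeling`:
# the SPLIT LEMMA for generalized layouts — schedule, then block-triangular split

Helper file (`--supports stmt-ValiantsHypothesis-22510`; cell valiant-natproofs, rung V4, 𝒟-side door (c); registered line
`Cruxes/AnchoredDoorHitsLowerPairs/Lines/anchored_peeling.lean` v10; prover seat val-np-p1 gen 18). One bookkeeping `def` (`sKey`, the
first-fit key of a column with respect to a list of shifts). Closes NO item; asserts NO conjecture.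

THE DEVICE (memo HOME/val-np-p1/g18/DTS-MEMO-valnp1-g18.md §7). A GENERALIZED LAYOUT has rows `(U_i | E_i)` (file `…DTPeelSpec`, p594944:
entry `[E_i ⊆ T]·[x^{U_i} y^{T∖E_i}] 𝔄_s` against the column `T`); valid DT-peel SCHEDULES (file `…Routing`, p595531) transform the ordinary
layout `(u_i | ∅)` into such rows and transfer non-vanishing back (`genDet_ne_zero_of_schedule`). List the distinct shifts that occur as
`S_0, …, S_{m-1}` (row `i` has shift `S_{rk i}`) and give each COLUMN its first-fit key: the first `j` with `S_j ⊆ T`. A row of shift `S_j`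
is supported on columns of key `≤ j`, so under the SIZE CONDITION «as many rows of shift `S_j` as columns of key `j`, for every `j`» a column
permutation makes the matrix BLOCK-TRIANGULAR and its determinant is, up to sign, the product of the symbolic minors of the SUB-PAIRS
`({U_i : rk i = j}, {T ∖ S_j : key T = j})`.

* `genDet_ne_zero_of_split` — the split lemma for an arbitrary generalized layout.
* `symbolicDet_ne_zero_of_schedule_split` — **SCHEDULE + SPLIT**: a valid `x`-side schedule followed by a split whose sub-pairs have nonzero
  symbolic minors certifies `symbolicDet s h r u w ≠ 0` (`s ≥ 1`). A ROUTING (p595531) is the case where every block is `1 × 1` with entry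
  `[x^∅ y^∅]𝔄 = 1`; the DECOMPOSING DT-STAGE (`…DTSStep`, p603111) is the case of a one-stage schedule. For lower pairs the sub-pairs are
  lower pairs (x-side blocks of a schedule stay lower; first-fit column classes of a lower family are lower), so this is the general
  induction step behind the line's combinatorial certificates («split routings»).

WHAT THIS IS NOT: no existence claim for schedules/splits; nothing on items 22510 / 19717 themselves, on crux stmt-ValiantsHypothesis-14610
or on `VP` versus `VNP`.
-/

set_option linter.dupNamespace false

namespace Summit.ValiantsHypothesis.ValiantsHypothesis.Theorems.BarrierLever.AnchoredPeeling

open Finset MvPolynomial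
open Summit.ValiantsHypothesis.ValiantsHypothesis.Theorems.BarrierLever.BrickCalculus (pexpo pexpo_def)

noncomputable section

namespace DTPeel

variable {h : ℕ}

section Split

variable {r m : ℕ} (w : Fin r → Finset (Fin h)) (S : Fin m → Finset (Fin h))

/-- The shifts of the list `S` contained in the column `w k`. -/
def shiftsIn (k : Fin r) : Finset (Fin m) := univ.filter fun j => S j ⊆ w k

/-- First-fit key of a column with respect to the shift list `S`: the first `j` with `S j ⊆ w k` (as a natural number; `m` if none). -/
def sKey (k : Fin r) : ℕ :=
  if hk : (shiftsIn w S k).Nonempty then ((shiftsIn w S k).min' hk : ℕ) else m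

variable {w S}

/-- Membership in `shiftsIn`. -/
theorem mem_shiftsIn {k : Fin r} {j : Fin m} : j ∈ shiftsIn w S k ↔ S j ⊆ w k := by
  rw [shiftsIn, Finset.mem_filter]
  exact ⟨fun hj => hj.2, fun hj => ⟨Finset.mem_univ _, hj⟩⟩

/-- Keys are at most `m`. -/
theorem sKey_le (k : Fin r) : sKey w S k ≤ m := by
  rw [sKey]
  split_ifs with hk
  · exact ((shiftsIn w S k).min' hk).2.le
  · exact le_rfl

/-- A column containing the shift `S j` has key at most `j`. -/
theorem sKey_le_of_subset {k : Fin r} {j : Fin m} (hj : S j ⊆ w k) : sKey w S k ≤ j := by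
  have hmem : j ∈ shiftsIn w S k := mem_shiftsIn.mpr hj
  have hk : (shiftsIn w S k).Nonempty := ⟨j, hmem⟩
  rw [sKey, dif_pos hk]
  exact_mod_cast Finset.min'_le _ _ hmem

/-- Key `j < m` characterises the columns whose FIRST contained shift is `S j`. -/
theorem sKey_eq_iff (k : Fin r) (j : Fin m) :
    sKey w S k = j ↔ S j ⊆ w k ∧ ∀ j', j' < j → ¬ S j' ⊆ w k := by
  constructor
  · intro hk
    have hne : (shiftsIn w S k).Nonempty := by
      by_contra hne
      rw [sKey, dif_neg hne] at hk
      exact absurd hk.symm j.2.ne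
    rw [sKey, dif_pos hne] at hk
    have hkj : (shiftsIn w S k).min' hne = j := Fin.ext hk
    refine ⟨mem_shiftsIn.mp (hkj ▸ Finset.min'_mem _ hne), fun j' hj' hsub => ?_⟩
    have hle := Finset.min'_le (shiftsIn w S k) j' (mem_shiftsIn.mpr hsub)
    rw [hkj] at hle
    exact absurd hj' (not_lt.mpr hle)
  · rintro ⟨hsub, hmin⟩
    have hne : (shiftsIn w S k).Nonempty := ⟨j, mem_shiftsIn.mpr hsub⟩
    rw [sKey, dif_pos hne]
    have hkj : (shiftsIn w S k).min' hne = j := by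
      refine le_antisymm (Finset.min'_le _ _ (mem_shiftsIn.mpr hsub)) ?_
      by_contra hlt
      exact hmin _ (not_le.mp hlt) (mem_shiftsIn.mp (Finset.min'_mem _ hne))
    rw [hkj]

/-- The size condition for the keys `j < m` forces the fibre counts of row keys and column keys to agree everywhere
(in particular no column is key-less). -/
theorem card_rk_eq_card_sKey (rk : Fin r → Fin m)
    (hcount : ∀ j : Fin m, (univ.filter fun i => rk i = j).card =
      (univ.filter fun k => S j ⊆ w k ∧ ∀ j', j' < j → ¬ S j' ⊆ w k).card)
    (v : ℕ) : (univ.filter fun i => (rk i : ℕ) = v).card = (univ.filter fun k => sKey w S k = v).card := by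
  have hlt : ∀ v, v < m → (univ.filter fun i => (rk i : ℕ) = v).card = (univ.filter fun k => sKey w S k = v).card := by
    intro v hv
    have h1 : (univ.filter fun i => (rk i : ℕ) = v) = univ.filter fun i => rk i = ⟨v, hv⟩ :=
      Finset.filter_congr (fun i _ => by
        constructor
        · intro hi; exact Fin.ext hi
        · intro hi; rw [hi])
    have h2 : (univ.filter fun k => sKey w S k = v) =
        univ.filter fun k => S ⟨v, hv⟩ ⊆ w k ∧ ∀ j', j' < ⟨v, hv⟩ → ¬ S j' ⊆ w k :=
      Finset.filter_congr (fun k _ => sKey_eq_iff k ⟨v, hv⟩)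
    rw [h1, h2, hcount]
  rcases lt_trichotomy v m with hv | hv | hv
  · exact hlt v hv
  · rw [hv]
    have hr : (univ : Finset (Fin r)).card = ∑ b ∈ Finset.range (m + 1), (univ.filter fun i => (rk i : ℕ) = b).card :=
      Finset.card_eq_sum_card_fiberwise (fun i _ => Finset.mem_coe.mpr (Finset.mem_range.mpr (Nat.lt_succ_of_lt (rk i).2)))
    have hc : (univ : Finset (Fin r)).card = ∑ b ∈ Finset.range (m + 1), (univ.filter fun k => sKey w S k = b).card :=
      Finset.card_eq_sum_card_fiberwise (fun k _ => Finset.mem_coe.mpr (Finset.mem_range.mpr (Nat.lt_succ_of_le (sKey_le k))))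
    rw [Finset.sum_range_succ] at hr hc
    have hsum : ∑ b ∈ Finset.range m, (univ.filter fun i => (rk i : ℕ) = b).card =
        ∑ b ∈ Finset.range m, (univ.filter fun k => sKey w S k = b).card :=
      Finset.sum_congr rfl (fun b hb => hlt b (Finset.mem_range.mp hb))
    omega
  · have h1 : (univ.filter fun i => (rk i : ℕ) = v) = ∅ :=
      Finset.filter_eq_empty_iff.mpr (fun i _ hi => absurd (hi ▸ (rk i).2.le) (not_le.mpr hv))
    have h2 : (univ.filter fun k => sKey w S k = v) = ∅ :=
      Finset.filter_eq_empty_iff.mpr (fun k _ hk => absurd (hk ▸ sKey_le k) (not_le.mpr hv))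
    rw [h1, h2]

variable {s : ℕ} {U E : Fin r → Finset (Fin h)} {rk : Fin r → Fin m}

/-- The block of key `j` is the symbolic minor of an enumeration of the sub-pair `({U_i : rk i = j}, {T ∖ S_j : key T = j})`. -/
theorem det_splitBlock_ne_zero (hw : Function.Injective w) (hUE : ∀ i i', U i = U i' → E i = E i' → i = i')
    (hrk : ∀ i, E i = S (rk i)) (σ : Equiv.Perm (Fin r)) (hσ : ∀ x, sKey w S (σ x) = (rk x : ℕ)) (j : Fin m)
    (hblk : ∀ (r₁ : ℕ) (u₁ w₁ : Fin r₁ → Finset (Fin h)), Function.Injective u₁ → Function.Injective w₁ →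
      Set.range u₁ = {V | ∃ i, rk i = j ∧ U i = V} →
      Set.range w₁ = {T | Disjoint T (S j) ∧ T ∪ S j ∈ Set.range w ∧ ∀ j', j' < j → ¬ S j' ⊆ T ∪ S j} →
      symbolicDet s h r₁ u₁ w₁ ≠ 0) :
    (Matrix.of fun x y : {x : Fin r // (rk x : ℕ) = (j : ℕ)} => genEntry s h (U x.1) (E x.1) (w (σ y.1))).det ≠ 0 := by
  classical
  have hxj : ∀ x : {x : Fin r // (rk x : ℕ) = (j : ℕ)}, rk x.1 = j := fun x => Fin.ext x.2
  have hxE : ∀ x : {x : Fin r // (rk x : ℕ) = (j : ℕ)}, E x.1 = S j := fun x => by rw [hrk, hxj x]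
  have hyk : ∀ y : {x : Fin r // (rk x : ℕ) = (j : ℕ)}, sKey w S (σ y.1) = (j : ℕ) := fun y => by rw [hσ]; exact y.2
  have hys : ∀ y : {x : Fin r // (rk x : ℕ) = (j : ℕ)}, S j ⊆ w (σ y.1) := fun y => ((sKey_eq_iff _ j).mp (hyk y)).1
  have hymin : ∀ y : {x : Fin r // (rk x : ℕ) = (j : ℕ)}, ∀ j', j' < j → ¬ S j' ⊆ w (σ y.1) := fun y =>
    ((sKey_eq_iff _ j).mp (hyk y)).2
  have hM : (Matrix.of fun x y : {x : Fin r // (rk x : ℕ) = (j : ℕ)} => genEntry s h (U x.1) (E x.1) (w (σ y.1))) =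
      Matrix.of fun x y : {x : Fin r // (rk x : ℕ) = (j : ℕ)} => coeff (pexpo (U x.1) (w (σ y.1) \ S j)) (symbolicWitness s h) := by
    ext x y
    rw [Matrix.of_apply, Matrix.of_apply, hxE x, genEntry, if_pos (hys y)]
  rw [hM]
  set e := Fintype.equivFin {x : Fin r // (rk x : ℕ) = (j : ℕ)} with he
  have h1 : Function.Injective (fun k : Fin (Fintype.card {x : Fin r // (rk x : ℕ) = (j : ℕ)}) => U (e.symm k).1) := by
    intro k k' hkk
    have hEE : E (e.symm k).1 = E (e.symm k').1 := by rw [hxE, hxE]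
    exact e.symm.injective (Subtype.ext (hUE _ _ hkk hEE))
  have h2 : Function.Injective (fun k : Fin (Fintype.card {x : Fin r // (rk x : ℕ) = (j : ℕ)}) => w (σ (e.symm k).1) \ S j) := by
    intro k k' hkk
    have hk : w (σ (e.symm k).1) = w (σ (e.symm k').1) := by
      have h2 := congrArg (fun T => T ∪ S j) hkk
      simp only [Finset.sdiff_union_of_subset (hys _)] at h2
      exact h2
    exact e.symm.injective (Subtype.ext (σ.injective (hw hk)))
  have h3 : Set.range (fun k : Fin (Fintype.card {x : Fin r // (rk x : ℕ) = (j : ℕ)}) => U (e.symm k).1) =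
      {V | ∃ i, rk i = j ∧ U i = V} := by
    ext V
    constructor
    · rintro ⟨k, rfl⟩
      exact ⟨(e.symm k).1, hxj _, rfl⟩
    · rintro ⟨i, hi, rfl⟩
      refine ⟨e ⟨i, by rw [hi]⟩, ?_⟩
      simp only [Equiv.symm_apply_apply]
  have h4 : Set.range (fun k : Fin (Fintype.card {x : Fin r // (rk x : ℕ) = (j : ℕ)}) => w (σ (e.symm k).1) \ S j) =
      {T | Disjoint T (S j) ∧ T ∪ S j ∈ Set.range w ∧ ∀ j', j' < j → ¬ S j' ⊆ T ∪ S j} := by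
    ext T
    constructor
    · rintro ⟨k, rfl⟩
      refine ⟨Finset.sdiff_disjoint, ⟨σ (e.symm k).1, ?_⟩, ?_⟩
      · simp only [Finset.sdiff_union_of_subset (hys _)]
      · intro j' hj'
        simp only [Finset.sdiff_union_of_subset (hys _)]
        exact hymin _ j' hj'
    · rintro ⟨hdT, ⟨k, hk⟩, hminT⟩
      have hck : sKey w S k = (j : ℕ) :=
        (sKey_eq_iff k j).mpr ⟨hk ▸ Finset.subset_union_right, fun j' hj' => hk ▸ hminT j' hj'⟩
      have hry : (rk (σ.symm k) : ℕ) = (j : ℕ) := by rw [← hσ, Equiv.apply_symm_apply]; exact hck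
      refine ⟨e ⟨σ.symm k, hry⟩, ?_⟩
      simp only [Equiv.symm_apply_apply, Equiv.apply_symm_apply, hk, Finset.union_sdiff_cancel_right hdT]
  have key := hblk _ _ _ h1 h2 h3 h4
  have hsub : symbolicDet s h _ (fun k => U (e.symm k).1) (fun k => w (σ (e.symm k).1) \ S j) =
      ((Matrix.of fun x y : {x : Fin r // (rk x : ℕ) = (j : ℕ)} =>
        coeff (pexpo (U x.1) (w (σ y.1) \ S j)) (symbolicWitness s h)).submatrix e.symm e.symm).det := rfl
  rwa [hsub, Matrix.det_submatrix_equiv_self] at key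

/-- **THE SPLIT LEMMA.** A generalized layout `(U_i | E_i)` against injective columns `w`, with pairwise distinct rows, whose shifts are
listed as `S_0, …, S_{m-1}` (`E_i = S_{rk i}`), and which satisfies the SIZE CONDITION «as many rows of shift `S_j` as columns whose first
contained shift is `S_j`», has nonzero generalized symbolic minor as soon as every sub-pair `({U_i : rk i = j}, {T ∖ S_j : key T = j})` has
nonzero symbolic minor (for all injective enumerations). -/
theorem genDet_ne_zero_of_split (hw : Function.Injective w) (hUE : ∀ i i', U i = U i' → E i = E i' → i = i')
    (hrk : ∀ i, E i = S (rk i))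
    (hcount : ∀ j : Fin m, (univ.filter fun i => rk i = j).card =
      (univ.filter fun k => S j ⊆ w k ∧ ∀ j', j' < j → ¬ S j' ⊆ w k).card)
    (hblk : ∀ (j : Fin m) (r₁ : ℕ) (u₁ w₁ : Fin r₁ → Finset (Fin h)), Function.Injective u₁ → Function.Injective w₁ →
      Set.range u₁ = {V | ∃ i, rk i = j ∧ U i = V} →
      Set.range w₁ = {T | Disjoint T (S j) ∧ T ∪ S j ∈ Set.range w ∧ ∀ j', j' < j → ¬ S j' ⊆ T ∪ S j} →
      symbolicDet s h r₁ u₁ w₁ ≠ 0) :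
    genDet s h r U E w ≠ 0 := by
  classical
  have hfib : ∀ v : ℕ, Fintype.card {i : Fin r // (rk i : ℕ) = v} = Fintype.card {k : Fin r // sKey w S k = v} := by
    intro v
    rw [Fintype.card_subtype, Fintype.card_subtype]
    exact card_rk_eq_card_sKey rk hcount v
  let σ : Fin r ≃ Fin r :=
    Equiv.ofFiberEquiv (f := fun i => (rk i : ℕ)) (g := sKey w S) (fun v => Fintype.equivOfCardEq (hfib v))
  have hσ : ∀ x, sKey w S (σ x) = (rk x : ℕ) := fun x => Equiv.ofFiberEquiv_map _ x
  set N : Matrix (Fin r) (Fin r) (MvPolynomial (Param h) ℂ) :=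
    Matrix.of fun x y => genEntry s h (U x) (E x) (w (σ y)) with hN
  have hNM : N = (genMatrix s h r U E w).submatrix id σ := by
    ext x y; rfl
  intro h0
  have hN0 : N.det = 0 := by
    rw [hNM, Matrix.det_permute', ← genDet, h0, mul_zero]
  have hBT : N.BlockTriangular (OrderDual.toDual ∘ fun i => (rk i : ℕ)) := by
    intro x y hlt
    have hlt' : (rk x : ℕ) < (rk y : ℕ) := OrderDual.toDual_lt_toDual.mp hlt
    by_contra hne
    have hsub : E x ⊆ w (σ y) := by
      by_contra hns
      apply hne
      show genEntry s h (U x) (E x) (w (σ y)) = 0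
      rw [genEntry, if_neg hns]
    have hle : sKey w S (σ y) ≤ (rk x : ℕ) := by
      rw [hrk] at hsub
      exact sKey_le_of_subset hsub
    rw [hσ] at hle
    omega
  rw [Matrix.BlockTriangular.det hBT] at hN0
  obtain ⟨v, hv, hv0⟩ := Finset.prod_eq_zero_iff.mp hN0
  obtain ⟨x₀, -, hx₀⟩ := Finset.mem_image.mp hv
  subst hx₀
  let ε : {x : Fin r // (OrderDual.toDual ∘ fun i => (rk i : ℕ)) x = (OrderDual.toDual ∘ fun i => (rk i : ℕ)) x₀} ≃
      {x : Fin r // (rk x : ℕ) = (rk x₀ : ℕ)} :=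
    Equiv.subtypeEquivRight (fun x => OrderDual.toDual_inj)
  have hblock : N.toSquareBlock (OrderDual.toDual ∘ fun i => (rk i : ℕ)) ((OrderDual.toDual ∘ fun i => (rk i : ℕ)) x₀) =
      (Matrix.of fun x y : {x : Fin r // (rk x : ℕ) = (rk x₀ : ℕ)} =>
        genEntry s h (U x.1) (E x.1) (w (σ y.1))).submatrix ε ε := by
    ext p q; rfl
  rw [hblock, Matrix.det_submatrix_equiv_self] at hv0
  exact det_splitBlock_ne_zero hw hUE hrk σ hσ (rk x₀) (hblk (rk x₀)) hv0

/-- **SCHEDULE + SPLIT.** A valid `x`-side schedule of DT-peel stages (`…Routing`) followed by a split of the resulting generalized layout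
certifies the symbolic minor (`s ≥ 1`). -/
theorem symbolicDet_ne_zero_of_schedule_split (hs : 1 ≤ s) (u : Fin r → Finset (Fin h)) (hw : Function.Injective w)
    (L : List (Stage h r)) (hv : ValidSched L u (fun _ => ∅))
    (hUE : ∀ i i', runU L u i = runU L u i' → runE L u (fun _ => ∅) i = runE L u (fun _ => ∅) i' → i = i')
    (hrk : ∀ i, runE L u (fun _ => ∅) i = S (rk i))
    (hcount : ∀ j : Fin m, (univ.filter fun i => rk i = j).card =
      (univ.filter fun k => S j ⊆ w k ∧ ∀ j', j' < j → ¬ S j' ⊆ w k).card)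
    (hblk : ∀ (j : Fin m) (r₁ : ℕ) (u₁ w₁ : Fin r₁ → Finset (Fin h)), Function.Injective u₁ → Function.Injective w₁ →
      Set.range u₁ = {V | ∃ i, rk i = j ∧ runU L u i = V} →
      Set.range w₁ = {T | Disjoint T (S j) ∧ T ∪ S j ∈ Set.range w ∧ ∀ j', j' < j → ¬ S j' ⊆ T ∪ S j} →
      symbolicDet s h r₁ u₁ w₁ ≠ 0) :
    symbolicDet s h r u w ≠ 0 := by
  rw [← genDet_empty]
  exact genDet_ne_zero_of_schedule hs w L u _ hv (genDet_ne_zero_of_split hw hUE hrk hcount hblk)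

end Split

end DTPeel

end

end Summit.ValiantsHypothesis.ValiantsHypothesis.Theorems.BarrierLever.AnchoredPeeling
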